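import Literature.MathematicalPhysics.QuantumFieldTheory.Balaban1983to89.B9Eq326DeltaAEtaScalingZdPer
import Literature.MathematicalPhysics.QuantumFieldTheory.Balaban1983to89.B7Eq124PrintedGrouping
import Literature.MathematicalPhysics.QuantumFieldTheory.Balaban1983to89.B9Thm311PosDefOpenRegimeZd

/-!
# `Balaban1983to89.B9Eq326AbelianRecordLettersZdPer` — [Balaban1985BackgroundPropagators] (3.26) p. 395 for the GENUINE periodic record AT A COMMUTATIVE COEFFICIENT
# ALGEBRA (the programme's bookkeeping record has `𝔸 := ℂ`, `Node00.Record12Numerics.stage3OfRecord₁₂`): the adjoint action `R(u)X = uXu⁻¹` is the identity, so the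
# letters `D*D` (1.55), `D R^per D*` (3.20)–(3.26) and — on the all-torus members, for backgrounds in the letter's regime window — `Q*aQ` (3.16) DO NOT SEE THE
# BACKGROUND, and `Δ_a(U₀) = Δ_a(1) + Δ′(U₀)` EXACTLY; [Balaban1985Averaging]'s linearised averaging `LQ(V₀)A` (122)∕(124) is its flat main term `L·Q₀A` (125)

statement-level skeleton of published theorems with citation tags; proofs where landed; nothing here is a claim about the Yang–Mills mass gap

`[Balaban1985BackgroundPropagators]` ("B9", CMP **99** (1985) 389–434): (3.4) p. 391, (3.8)–(3.10) p. 392, (3.16), (3.19) p. 393, (3.20)–(3.23) p. 394, (3.26)–(3.27) p. 395,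
Thm 3.11 p. 416.  `[Balaban1985Averaging]` ("B7", CMP **98** (1985) 17–51): (42)–(43) pp. 23–24, (56)–(58) p. 27, p. 35 (the identities `g(±i ad_Y)`), (122)–(125) p. 36,
p. 38 *«Q_{j+1}(U₀) = Q(Ū₀ʲ)Q_j(U₀)»*, Prop. 2 p. 26.  `[Balaban1985RegularSpaces]` ("B8", CMP **99**): (1.1)–(1.2) p. 76, (1.7) p. 77, (1.55)–(1.58) p. 86, p. 77 *«Ω_j = T_η»*.
PDF held: `paper:balaban1985-cmp99-background-propagators` pp. 391–395, 416 (re-read by this seat, 2026-08-29).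

CITATION HEADER (lean-in-tree rule).  Cell `pub-ymgap` (YM Track A), DAG node N06 = [B9], seat `pub-ymgap-dag-n06-b` (g26), the (β′-PERIODIC) road.  WHY (LOCATED-SELF-10 of
this seat, 2026-08-29): the programme's record of record — the `Stage3Params` at which the K1 face `BalabanUVNodesN24K1FaceN06BindersJunction…` (dag-n24-c p688041) and
every `stage3OfFamily F` are read — has the COMMUTATIVE coefficient algebra `𝔸 := ℂ` (`Node00/Record12Numerics.lean` :188).  At a commutative `𝔸` every conjugation
`R(U₀(b))`, `R(U₀(Γ))` in [B7]∕[B8]∕[B9] is the identity, so the N06 letters this lineage typed (`opsAllZdPer`) collapse to their values at `U₀ = 1` — except the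
curvature letter `Δ′(U₀)` of (3.10), whose weights `η⁻²(Re U(∂p) − 1)`, `η⁻² Im U(∂p)` genuinely read the plaquettes (the commutator part vanishes).  THIS FILE is the
kernel certificate of that located fact; its sequel derives [B9] Thm 3.11 for the genuine record UNIFORMLY IN THE VOLUME at such an algebra (flat coercivity of
dag-n06-w3's `B9Thm311FlatCoercivityAllLettersZdPer` + the (3.69) bound on `Δ′`).  It is NOT a statement about the non-abelian theorem and changes no count.

WHAT IS PROVED (kernel, 0 sorry; theorems only — no `def`, no `instance`, no `notation`; every statement under the displayed hypothesis `hcomm : ∀ a b : 𝔸, a * b = b * a`).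
* §1 `conjR_eq_self`; `covDerivFwd_eq_one`, `covDeriv_eq_one`, `covDivB_eq_one`, `covLap_eq_one`, `lin_eq_one`, `plaqCovDeriv_eq_one`, `pdiv_eq_one`, ★ `Jcur_eq_one` (the (1.1)∕
  (1.2)∕(3.4)∕(3.23)∕(1.55) stencils at `V` equal the stencils at `1`, as functions).
* §2 `Qprime_eq_of_comm`, `QprimeIter_eq_of_comm` (any transporters), `gaugeNullPer_eq_one`, `rangeGenPer_eq_one`, ★ `projRPer_eq_one` (`R^per(U₀) = R^per(1)`, every background,
  no `τ`-hypothesis), ★ `DRDs_opsAllZdPer_eq_one`.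
* §3 private `Dexp_apply_of_comm` (`(D exp)_Y X = X e^Y`), `Dmlog_apply_of_comm` (`(D log)_W Z = Z W⁻¹`, `‖W − 1‖ < 1`) — the tree's
  `ExpFDeriv.fderiv_exp_apply_of_commute` ∕ `LogFDeriv.fderiv_logOnePlus_apply_of_commute` BY NAME; `PhiY_apply_of_comm`, `PsiW_apply_of_comm` (`g(±i ad) = 1`); `tsum_eq_one`, `Q0cov_eq_one`; ★★
  `linQcov_eq_smul_Q0cov_of_comm` ((124) ⟹ `LQ(V₀)A = L·Q₀A` under [B7]'s disc condition `‖W_x(V₀) − 1‖ < 1`), ★★ `linQcov_eq_one_of_comm`, ★★ `linCovIter_eq_one_of_comm`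
  (the composite `LʲηQ_j(U₀)` under the disc conditions for `Ū₀^{j′}`, `j′ < j`), `linCovIterT_eq_one_of_comm`, ★★★ `QQZdP_eq_one_of_comm` (all-torus members `Ω_j = ℤᵈ`,
  unitary `U₀` in the regime window `Reg17 … (α_Q∕L²)`: the disc conditions by dag-n06-w4's `wcx_avgIter_lt_one_of_reg17UnivP`), ★★★
  `deltaAOf_opsAllZdPer_eq_one_add_DpZd_of_comm` (`Δ_a(U₀)A = Δ_a(1)A + Δ′(U₀)A`).

HONEST SCOPE.  (i) Pure algebra at a commutative coefficient algebra; the record's `𝔸 = ℂ` is the bookkeeping witness of `Node00/Record12Numerics` — whether record-level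
readings may use its commutativity is a desk matter, not this file's; for a NON-commutative `𝔸` nothing here applies and [B9] Sects. B–C remain the road.  (ii) §3's
background-freeness of `Q*aQ` is proved at the ALL-TORUS members (`Ω_j = ℤᵈ`); at nested members the disc conditions on the class boxes would come from `Reg17` + locality
(not here).  (iii) Count-neutral; N06 NOT discharged; K1⁹ NOT closed; counts UNMOVED; one finite `𝕋⁴` programme at fixed `ε`, Bałaban as printed; nothing continuum ∕ ℝ⁴
∕ OS ∕ mass gap ∕ Clay.  Unit `pub-ymgap-dag-n06-b` (g26), 2026-08-29; NEW file importing this seat's `B9Eq326DeltaAEtaScalingZdPer` (p686673), dag-n06-w4's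
`B9Thm311PosDefOpenRegimeZd`, lit-balaban's `B7Eq124PrintedGrouping`; modifies nothing.  Net new unproved facts: 0.
-/

noncomputable section

namespace Literature.MathematicalPhysics.QuantumFieldTheory.Balaban1983to89.B9Eq326AbelianRecordLettersZdPer

open NormedSpace
open B7Prop1Explicit B7Prop2Explicit
open B7Prop2Explicit (avgIter)
open B7Prop1Local (InBox loK bondHiK)
open B7Eq78Linearization (conjR conjR_apply Qprime QprimeIter zdBlocking)
open B7Prop3GeneralRotated (tstep tsum)
open B7Prop3GeneralLinear (linQcov Q0cov)
open B7Prop4GeneralLevels (linCovIter)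
open B12AverageCorridor267 (Dmlog Dexp PhiY PsiW PhiY_apply PsiW_apply)
open B8Ineq132 (covDerivFwd covDeriv covDiv InAk plaqF BondTouches)
open B8Eq138LandauZd (covLap covDivB QT)
open B8Eq143PlaqExpansion (pdiv)
open B8Eq146AExpansion (iEta plaqCovDeriv lin X1 X2 X3 X4)
open B8Eq155JBound (Jcur)
open B8Eq119TwistedAxial (bgT)
open B8LeafModelZd (ZdIdx)
open B9Eq369CurvSmallZd (DpZd)
open B9SupplySockB9P3ZdLetters (OpsZd deltaAOf)
open B9Eq316AveragingTransposeZd (Reg17 clsField wQ alphaQ alphaQ_pos linCovIterT reg17_one)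
open B9Eq316AveragingTransposeZdPrinted (QQZdP)
open B9SupplySockB9P3ZdAllLettersZdPer (opsAllZdPer opsLandauPer opsAllZdPer_DRDs opsAllZdPer_Dp opsAllZdPer_QQ)
open B9Eq321LandauProjectionZdPer (perSub gaugeNullPer rangeGenPer rangeSubPer projEPer projRPer)
open B9Thm311PosDefOpenRegimeZd (wcx_avgIter_lt_one_of_reg17UnivP)
open T4TermwiseTorus (IsPeriodic)

-- `Site` alone could resolve to the torus sites of `Setup.lean`; re-export the `ℤ^d` sites of `B7Prop1Explicit`.
export B7Prop1Explicit (Site)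

variable {d : ℕ} {𝔸 : Type*} [CStarAlgebra 𝔸]

/-! ## §1  At a commutative coefficient algebra the adjoint action is trivial: the derivative letters do not see the background -/

section Flat

variable (hcomm : ∀ a b : 𝔸, a * b = b * a)
include hcomm

/-- **AT A COMMUTATIVE ALGEBRA `R(u)X = uXu⁻¹ = X`.** [cite: Balaban1985Averaging, (56) p.27 (the adjoint action; commutative case)] -/
theorem conjR_eq_self (u : 𝔸ˣ) (X : 𝔸) : conjR u X = X := by
  rw [conjR_apply, hcomm (u : 𝔸) X, mul_assoc, Units.mul_inv, mul_one]

/-- (1.1): the forward covariant derivative is the flat forward derivative. [cite: Balaban1985RegularSpaces, (1.1) p.76 (commutative case)] -/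
theorem covDerivFwd_eq_one (η : ℝ) (V : Site d → Fin d → 𝔸ˣ) : covDerivFwd η V = covDerivFwd η (1 : Site d → Fin d → 𝔸ˣ) := by
  funext μ F x
  simp only [covDerivFwd, conjR_eq_self hcomm]

/-- (1.1): the backward covariant derivative is flat. [cite: Balaban1985RegularSpaces, (1.1) p.76 (commutative case)] -/
theorem covDeriv_eq_one (η : ℝ) (V : Site d → Fin d → 𝔸ˣ) : covDeriv η V = covDeriv η (1 : Site d → Fin d → 𝔸ˣ) := by
  funext ν F x
  simp only [covDeriv, conjR_eq_self hcomm]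

/-- `D^{η*}` on bond fields is flat. [cite: Balaban1985BackgroundPropagators, (3.8) p.392 (commutative case)] -/
theorem covDivB_eq_one (η : ℝ) (U₀ : Site d → Fin d → 𝔸ˣ) : covDivB η U₀ = covDivB η (1 : Site d → Fin d → 𝔸ˣ) := by
  funext A x
  simp only [covDivB, covDeriv_eq_one hcomm η U₀]

/-- (3.23): the covariant Laplacian is the flat Laplacian. [cite: Balaban1985BackgroundPropagators, (3.23) p.394 (commutative case)] -/
theorem covLap_eq_one (η : ℝ) (U₀ : Site d → Fin d → 𝔸ˣ) : covLap η U₀ = covLap η (1 : Site d → Fin d → 𝔸ˣ) := by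
  funext f x
  simp only [covLap, covDivB_eq_one hcomm η U₀, covDerivFwd_eq_one hcomm η U₀]

/-- (3.4): the first-order plaquette term is flat. [cite: Balaban1985BackgroundPropagators, (3.4) p.391 (commutative case)] -/
theorem lin_eq_one (U₀ : Site d → Fin d → 𝔸ˣ) : lin U₀ = lin (1 : Site d → Fin d → 𝔸ˣ) := by
  funext A μ ν x
  simp only [lin, X2, X3, conjR_eq_self hcomm]

/-- (3.4): the plaquette covariant derivative is flat. [cite: Balaban1985BackgroundPropagators, (3.4) p.391 (commutative case)] -/
theorem plaqCovDeriv_eq_one (η : ℝ) (U₀ : Site d → Fin d → 𝔸ˣ) : plaqCovDeriv η U₀ = plaqCovDeriv η (1 : Site d → Fin d → 𝔸ˣ) := by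
  funext A μ ν x
  simp only [plaqCovDeriv, lin_eq_one hcomm U₀]

/-- (1.2): the plaquette divergence is flat. [cite: Balaban1985RegularSpaces, (1.2) p.76 (commutative case)] -/
theorem pdiv_eq_one (η : ℝ) (V : Site d → Fin d → 𝔸ˣ) : pdiv η V = pdiv η (1 : Site d → Fin d → 𝔸ˣ) := by
  funext F μ x
  simp only [pdiv, covDeriv_eq_one hcomm η V]

/-- ★ **(1.55): THE `D*D` LETTER DOES NOT SEE THE BACKGROUND at a commutative algebra.** [cite: Balaban1985RegularSpaces, (1.55) p.86; Balaban1985BackgroundPropagators, (3.10) p.392 (commutative case)] -/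
theorem Jcur_eq_one (η : ℝ) (U₀ : Site d → Fin d → 𝔸ˣ) : Jcur η U₀ = Jcur η (1 : Site d → Fin d → 𝔸ˣ) := by
  funext A μ x
  rw [Jcur, Jcur, plaqCovDeriv_eq_one hcomm η U₀, pdiv_eq_one hcomm η U₀]

/-! ## §2  The averaging stencils `Q′`, the Landau projection `R^per` and the letter `D R^per D*` are flat -/

omit [CStarAlgebra 𝔸] hcomm in
/-- the one-step stencil `Q′` with trivial transporters. [cite: Balaban1985BackgroundPropagators, (3.19) p.393 (commutative case)] -/
theorem Qprime_eq_of_comm {𝔸 : Type*} [NormedRing 𝔸] [NormedAlgebra ℂ 𝔸] (hcomm : ∀ a b : 𝔸, a * b = b * a)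
    {ι : Type*} (t : Finset ι) (w : ι → ℝ) (T T' : ι → 𝔸ˣ) (μ : ι → 𝔸) : Qprime t w T μ = Qprime t w T' μ := by
  simp only [B7Eq78Linearization.Qprime_apply]
  refine Finset.sum_congr rfl fun x _ => ?_
  rw [conjR_apply, conjR_apply, hcomm (T x : 𝔸), hcomm (T' x : 𝔸), mul_assoc, mul_assoc, Units.mul_inv, Units.mul_inv]

omit [CStarAlgebra 𝔸] hcomm in
/-- **`Q′_j` DOES NOT SEE THE TRANSPORTERS at a commutative algebra.** [cite: Balaban1985BackgroundPropagators, (3.19) p.393 (commutative case)] -/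
theorem QprimeIter_eq_of_comm {𝔸 : Type*} [NormedRing 𝔸] [NormedAlgebra ℂ 𝔸] (hcomm : ∀ a b : 𝔸, a * b = b * a)
    {ι : Type*} (G : B7Eq78Linearization.Blocking ι) (T T' : ℕ → ι → ι → 𝔸ˣ) : ∀ (j : ℕ) (μ : ι → 𝔸), QprimeIter G T j μ = QprimeIter G T' j μ
  | 0, μ => rfl
  | j + 1, μ => by
      funext y
      show Qprime (G.B j y) (G.wt j y) (T j y) (QprimeIter G T j μ) = Qprime (G.B j y) (G.wt j y) (T' j y) (QprimeIter G T' j μ)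
      rw [QprimeIter_eq_of_comm hcomm G T T' j μ, Qprime_eq_of_comm hcomm]

/-- `N^per(Q′(U₀)) = N^per(Q′(1))`. [cite: Balaban1985BackgroundPropagators, (3.21) p.394 (commutative case)] -/
theorem gaugeNullPer_eq_one (P L m : ℕ) (Λs : ℕ → Set (Site d)) (U₀ : Site d → Fin d → 𝔸ˣ) :
    gaugeNullPer (𝔸 := 𝔸) P L m Λs U₀ = gaugeNullPer P L m Λs (1 : Site d → Fin d → 𝔸ˣ) := by
  ext lam
  simp only [gaugeNullPer, Set.mem_setOf_eq, QprimeIter_eq_of_comm hcomm (zdBlocking d L) (bgT L U₀) (bgT L 1)]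

/-- `Δ^η_{U₀}N^per(Q′(U₀)) = Δ^η_1 N^per(Q′(1))` as sets. [cite: Balaban1985BackgroundPropagators, (3.21)–(3.23) p.394 (commutative case)] -/
theorem rangeGenPer_eq_one (P L m : ℕ) (η : ℝ) (Λs : ℕ → Set (Site d)) (U₀ : Site d → Fin d → 𝔸ˣ) :
    rangeGenPer (𝔸 := 𝔸) P L m η Λs U₀ = rangeGenPer P L m η Λs (1 : Site d → Fin d → 𝔸ˣ) := by
  ext w
  simp only [rangeGenPer, Set.mem_setOf_eq, gaugeNullPer_eq_one hcomm, covLap_eq_one hcomm η U₀]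

/-- ★ **THE LANDAU PROJECTION `R^per(U₀)` IS `R^per(1)` at a commutative algebra** (every background, no hypothesis on `τ`).
[cite: Balaban1985BackgroundPropagators, (3.21)–(3.22) p.394 (commutative case)] -/
theorem projRPer_eq_one (τ : 𝔸 →ₗ[ℂ] ℂ) (P L m : ℕ) (η : ℝ) (Λs : ℕ → Set (Site d)) (U₀ : Site d → Fin d → 𝔸ˣ) :
    projRPer τ P L m η Λs U₀ = projRPer τ P L m η Λs (1 : Site d → Fin d → 𝔸ˣ) := by
  have h : rangeSubPer (𝔸 := 𝔸) P L m η Λs U₀ = rangeSubPer P L m η Λs (1 : Site d → Fin d → 𝔸ˣ) := by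
    unfold rangeSubPer; rw [rangeGenPer_eq_one hcomm]
  funext f x
  unfold projRPer projEPer
  rw [h]

variable [FiniteDimensional ℝ 𝔸] (τ : 𝔸 →ₗ[ℂ] ℂ) (P : ℕ) {L : ℕ} (𝔅 : ℕ → ℕ → Set (Site d × Fin d)) (ops₀ : ℝ → ZdIdx d L → ℕ → OpsZd d 𝔸) (M : ℝ)
  (i : ZdIdx d L) (m : ℕ)

/-- ★ **THE `D R^per D*` LETTER OF THE GENUINE RECORD DOES NOT SEE THE BACKGROUND at a commutative algebra.**
[cite: Balaban1985BackgroundPropagators, (3.26) p.395, (3.20)–(3.22) p.394 (commutative case)] -/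
theorem DRDs_opsAllZdPer_eq_one (U₀ : Site d → Fin d → 𝔸ˣ) (A : Site d → Fin d → 𝔸) :
    (opsAllZdPer τ L P 𝔅 ops₀ M i m).DRDs U₀ A = (opsAllZdPer τ L P 𝔅 ops₀ M i m).DRDs 1 A := by
  funext x μ
  rw [opsAllZdPer_DRDs, opsAllZdPer_DRDs, projRPer_eq_one hcomm, covDivB_eq_one hcomm i.η U₀, covDerivFwd_eq_one hcomm i.η U₀]

end Flat

/-! ## §3  [B7]'s covariant averaging at a commutative algebra: the linear part `LQ(V₀)` does not see the background -/

section Averaging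

variable [Nontrivial 𝔸] (hcomm : ∀ a b : 𝔸, a * b = b * a)
include hcomm

/-- `(D exp)_Y X = X·e^Y` when everything commutes. [folklore] -/
private theorem Dexp_apply_of_comm (Y X : 𝔸) : Dexp Y X = X * exp Y := by
  unfold Dexp
  exact Literature.Analysis.SpecialFunctions.ExpFDeriv.fderiv_exp_apply_of_commute (𝕂 := ℂ) (hcomm Y X)

omit [Nontrivial 𝔸] in
/-- `(D log)_W Z = Z·W⁻¹` when everything commutes (`‖W − 1‖ < 1`). [folklore] -/
private theorem Dmlog_apply_of_comm {W : 𝔸} (hW : ‖W - 1‖ < 1) (Z : 𝔸) : Dmlog W Z = Z * Ring.inverse W := by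
  unfold Dmlog
  rw [Literature.Analysis.SpecialFunctions.LogFDeriv.fderiv_logOnePlus_apply_of_commute hW (hcomm _ _), add_sub_cancel]

/-- `Φ_Y = g(−i ad_Y) = 1` at a commutative algebra. [cite: Balaban1985Averaging, p.35 (the identities before (120); commutative case)] -/
theorem PhiY_apply_of_comm (Y X : 𝔸) : PhiY Y X = X := by
  have h1 : exp Y * exp (-Y) = (1 : 𝔸) := (expUnit Y).val_inv
  rw [PhiY_apply, Dexp_apply_of_comm hcomm, mul_assoc, h1, mul_one]

omit [Nontrivial 𝔸] in
/-- `Ψ_W = g⁻¹(i ad_{Y_x}) = 1` at a commutative algebra (`‖W − 1‖ < 1`, `W` a unit). [cite: Balaban1985Averaging, p.35 (commutative case)] -/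
theorem PsiW_apply_of_comm {W : 𝔸} (hW : ‖W - 1‖ < 1) (hWu : IsUnit W) (Z : 𝔸) : PsiW W Z = Z := by
  rw [PsiW_apply, Dmlog_apply_of_comm hcomm hW, hcomm W Z, mul_assoc, Ring.mul_inverse_cancel _ hWu, mul_one]

omit [Nontrivial 𝔸] in
/-- the rotated functional `(R_{0,x}A)(Γ)` does not see the background. [cite: Balaban1985Averaging, (58) p.27, p.28 (commutative case)] -/
theorem tsum_eq_one (V₀ : Site d → Fin d → 𝔸ˣ) (A : Site d → Fin d → 𝔸) : ∀ (x : Site d) (w : List (Letter d)),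
    tsum V₀ A x w = tsum (1 : Site d → Fin d → 𝔸ˣ) A x w
  | x, [] => rfl
  | x, l :: w => by
      rw [B7Prop3GeneralRotated.tsum_cons, B7Prop3GeneralRotated.tsum_cons, tsum_eq_one V₀ A (x + l.vec) w, conjR_eq_self hcomm,
        conjR_eq_self hcomm]
      congr 1
      simp only [tstep, conjR_eq_self hcomm]

omit [Nontrivial 𝔸] in
/-- (125): the main term `Q₀` does not see the background. [cite: Balaban1985Averaging, (125) p.36 (commutative case)] -/
theorem Q0cov_eq_one (L : ℕ) (V₀ : Site d → Fin d → 𝔸ˣ) (A : Site d → Fin d → 𝔸) (q : Site d) (κ : Fin d) :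
    Q0cov L V₀ A q κ = Q0cov L (1 : Site d → Fin d → 𝔸ˣ) A q κ := by
  unfold Q0cov
  refine Finset.sum_congr rfl fun r _ => ?_
  rw [conjR_eq_self hcomm, conjR_eq_self hcomm, tsum_eq_one hcomm]

/-- ★ **(124) AT A COMMUTATIVE ALGEBRA: `L(Q(V₀)A)_c = L·(Q₀A)_c`** — the four `[operator − 1]` remainders of (124) vanish (`g(±i ad) = 1`) under [B7]'s disc
condition `‖W_x(V₀) − 1‖ < 1` on the block. [cite: Balaban1985Averaging, (124)–(125) p.36 (commutative case)] -/
theorem linQcov_eq_smul_Q0cov_of_comm {L : ℕ} (hL : 1 ≤ L) (V₀ : Site d → Fin d → 𝔸ˣ) (A : Site d → Fin d → 𝔸) (q : Site d) (κ : Fin d)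
    (hW : ∀ r : Fin d → Fin L, ‖((Wcx L V₀ q κ (boxVec L r) : 𝔸ˣ) : 𝔸) - 1‖ < 1) :
    linQcov L V₀ A q κ = (L : ℝ) • Q0cov L V₀ A q κ := by
  have hL0 : (L : ℝ) ≠ 0 := by exact_mod_cast (show L ≠ 0 by omega)
  have hDm : ∀ (r : Fin d → Fin L) (T : 𝔸), Dmlog ((Wcx L V₀ q κ (boxVec L r) : 𝔸ˣ) : 𝔸) (T * ((Wcx L V₀ q κ (boxVec L r) : 𝔸ˣ) : 𝔸)) = T :=
    fun r T => by
      rw [Dmlog_apply_of_comm hcomm (hW r), mul_assoc, Ring.mul_inverse_cancel _ (Units.isUnit _), mul_one]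
  have hPs : ∀ (r : Fin d → Fin L) (T : 𝔸), PsiW ((Wcx L V₀ q κ (boxVec L r) : 𝔸ˣ) : 𝔸) T = T :=
    fun r T => PsiW_apply_of_comm hcomm (hW r) (Units.isUnit _) T
  rw [B7Eq124PrintedGrouping.linQcov_eq124 L hL V₀ A q κ hW]
  simp only [hDm, hPs, PhiY_apply_of_comm hcomm, conjR_eq_self hcomm, sub_self, smul_zero, Finset.sum_const_zero, add_zero, sub_zero]
  -- the last bracket: `e^{i ad_Y}T − g(−i ad_Y)Σ_x L^{−d} g⁻¹(i ad_{Y_x})T = T − L^d·L^{−d}·T = 0`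
  rw [Finset.sum_const, Finset.card_univ, Fintype.card_fun, Fintype.card_fin, Fintype.card_fin, ← Nat.cast_smul_eq_nsmul ℝ, smul_smul,
    Nat.cast_pow, mul_inv_cancel₀ (pow_ne_zero d hL0), one_smul, sub_self, add_zero]

/-- ★ **`LQ(V₀)A = LQ(1)A` AT A COMMUTATIVE ALGEBRA** under the disc condition at `V₀`. [cite: Balaban1985Averaging, (122), (124)–(125) p.36 (commutative case)] -/
theorem linQcov_eq_one_of_comm {L : ℕ} (hL : 1 ≤ L) (V₀ : Site d → Fin d → 𝔸ˣ) (A : Site d → Fin d → 𝔸) (q : Site d) (κ : Fin d)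
    (hW : ∀ r : Fin d → Fin L, ‖((Wcx L V₀ q κ (boxVec L r) : 𝔸ˣ) : 𝔸) - 1‖ < 1) :
    linQcov L V₀ A q κ = linQcov L (1 : Site d → Fin d → 𝔸ˣ) A q κ := by
  have hW1 : ∀ r : Fin d → Fin L, ‖((Wcx L (1 : Site d → Fin d → 𝔸ˣ) q κ (boxVec L r) : 𝔸ˣ) : 𝔸) - 1‖ < 1 := fun r => by
    rw [B8Ineq130.Wcx_one, Units.val_one, sub_self, norm_zero]; exact zero_lt_one
  rw [linQcov_eq_smul_Q0cov_of_comm hcomm hL V₀ A q κ hW, linQcov_eq_smul_Q0cov_of_comm hcomm hL 1 A q κ hW1, Q0cov_eq_one hcomm]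

/-- ★★ **THE COMPOSITE LINEAR AVERAGING `LʲηQ_j(U₀)` DOES NOT SEE THE BACKGROUND AT A COMMUTATIVE ALGEBRA** ([B7] p. 38 «Q_{j+1}(U₀) = Q(Ū₀ʲ)Q_j(U₀)»),
under the disc conditions for the averaged backgrounds `Ū₀^{j′}`, `j′ < j`. [cite: Balaban1985Averaging, p.38 (before (133)), (124) p.36 (commutative case)] -/
theorem linCovIter_eq_one_of_comm {L : ℕ} (hL : 1 ≤ L) (U₀ : Site d → Fin d → 𝔸ˣ) :
    ∀ (j : ℕ), (∀ j', j' < j → ∀ (q : Site d) (κ : Fin d) (r : Fin d → Fin L), ‖((Wcx L (avgIter L U₀ j') q κ (boxVec L r) : 𝔸ˣ) : 𝔸) - 1‖ < 1) →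
      ∀ B : Site d → Fin d → 𝔸, linCovIter L U₀ B j = linCovIter L (1 : Site d → Fin d → 𝔸ˣ) B j
  | 0, _, B => rfl
  | j + 1, hdisc, B => by
      funext z κ
      rw [B7Prop4GeneralLevels.linCovIter_succ, B7Prop4GeneralLevels.linCovIter_succ,
        linCovIter_eq_one_of_comm hL U₀ j (fun j' hj' => hdisc j' (Nat.lt_succ_of_lt hj')) B, B7Eq92Concrete.avgIter_one,
        linQcov_eq_one_of_comm hcomm hL (avgIter L U₀ j) _ _ κ (hdisc j (Nat.lt_succ_self j) _ κ)]

variable [FiniteDimensional ℝ 𝔸] (τ : 𝔸 →ₗ[ℂ] ℂ)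

/-- the transpose `Q_jᵀ` does not see the background at a commutative algebra (disc conditions below `j`). [cite: Balaban1985BackgroundPropagators, (3.16) p.393 (commutative case)] -/
theorem linCovIterT_eq_one_of_comm {L : ℕ} (hL : 1 ≤ L) (U₀ : Site d → Fin d → 𝔸ˣ) {j : ℕ}
    (hdisc : ∀ j', j' < j → ∀ (q : Site d) (κ : Fin d) (r : Fin d → Fin L), ‖((Wcx L (avgIter L U₀ j') q κ (boxVec L r) : 𝔸ˣ) : 𝔸) - 1‖ < 1)
    (B : Site d → Fin d → 𝔸) (y : Site d) (μ : Fin d) :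
    linCovIterT τ L U₀ j B y μ = linCovIterT τ L (1 : Site d → Fin d → 𝔸ˣ) j B y μ := by
  unfold linCovIterT
  simp only [linCovIter_eq_one_of_comm hcomm hL U₀ j hdisc]

/-- ★★★ **THE GENUINE AVERAGING LETTER `Q*aQ(U₀)` IS `Q*aQ(1)` AT A COMMUTATIVE ALGEBRA ON THE ALL-TORUS MEMBERS** — for every unitary background in the letter's regime window
(the class (1.7) at `α_Q∕L²`, `Ω_j = ℤᵈ` for every `j`): the window puts every averaged background in [B7]'s disc (`wcx_avgIter_lt_one_of_reg17UnivP`).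
[cite: Balaban1985BackgroundPropagators, (3.16) p.393; Balaban1985RegularSpaces, (1.56), (1.58) p.86, (1.7) p.77; Balaban1985Averaging, (124) p.36, Prop. 2 p.26 (commutative case)] -/
theorem QQZdP_eq_one_of_comm (hd : 0 < d) {L : ℕ} (hL : 2 ≤ L) (𝔅 : ℕ → ℕ → Set (Site d × Fin d)) {i : ZdIdx d L} (hΩ : ∀ j, i.Ω j = Set.univ) (m : ℕ)
    {U₀ : Site d → Fin d → 𝔸ˣ} (hU : ∀ x κ, U₀ x κ ∈ unitaryUnits 𝔸) (hreg : Reg17 L m i.Ω (alphaQ d L / (L : ℝ) ^ 2) U₀) (A : Site d → Fin d → 𝔸) :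
    QQZdP τ L 𝔅 i m U₀ A = QQZdP τ L 𝔅 i m (1 : Site d → Fin d → 𝔸ˣ) A := by
  classical
  have hL1 : 1 ≤ L := le_trans one_le_two hL
  have hα : 0 < alphaQ d L / (L : ℝ) ^ 2 := by have := alphaQ_pos d hL1; positivity
  have hΩ' : i.Ω = fun _ => (Set.univ : Set (Site d)) := funext hΩ
  have hreg' : Reg17 L m (fun _ => (Set.univ : Set (Site d))) (alphaQ d L / (L : ℝ) ^ 2) U₀ := hΩ' ▸ hreg
  have hdisc := wcx_avgIter_lt_one_of_reg17UnivP hd hL m hU hreg'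
  have hcls : ∀ j, j ≤ m → clsField L 𝔅 i.η m j U₀ A = clsField L 𝔅 i.η m j (1 : Site d → Fin d → 𝔸ˣ) A := fun j hj => by
    funext z κ
    simp only [clsField, linCovIter_eq_one_of_comm hcomm hL1 U₀ j (fun j' hj' => hdisc j' (le_trans hj'.le hj)) (iEta i.η A)]
  funext y μ
  unfold QQZdP
  rw [if_pos hreg, if_pos (reg17_one hL1 hα)]
  refine Finset.sum_congr rfl fun j hj => ?_
  have hjm : j ≤ m := Nat.lt_succ_iff.mp (Finset.mem_range.mp hj)
  rw [hcls j hjm, linCovIterT_eq_one_of_comm hcomm τ hL1 U₀ (fun j' hj' => hdisc j' (le_trans hj'.le hjm))]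

variable (P : ℕ) {L : ℕ} (𝔅 : ℕ → ℕ → Set (Site d × Fin d)) (ops₀ : ℝ → ZdIdx d L → ℕ → OpsZd d 𝔸) (M : ℝ)

/-- ★★★ **`Δ_a(U₀) = Δ_a(1) + Δ′(U₀)` FOR THE GENUINE PERIODIC RECORD AT A COMMUTATIVE COEFFICIENT ALGEBRA** (all-torus members, unitary `U₀` in the regime window):
the three letters `D*D`, `D R^per D*`, `Q*aQ` are their flat values and only the curvature letter `Δ′(U₀)` ((3.10), `Δ′(1) = 0`) sees the background.
[cite: Balaban1985BackgroundPropagators, (3.26) p.395, (3.10) p.392, (3.16) p.393, (3.20)–(3.23) p.394; Balaban1985RegularSpaces, p.77 («Ω_j = T_η»), (1.7) p.77 (commutative case)] -/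
theorem deltaAOf_opsAllZdPer_eq_one_add_DpZd_of_comm (hd : 0 < d) (hL : 2 ≤ L) {i : ZdIdx d L} (hΩ : ∀ j, i.Ω j = Set.univ) (m : ℕ)
    {U₀ : Site d → Fin d → 𝔸ˣ} (hU : ∀ x κ, U₀ x κ ∈ unitaryUnits 𝔸) (hreg : Reg17 L m i.Ω (alphaQ d L / (L : ℝ) ^ 2) U₀) (A : Site d → Fin d → 𝔸) :
    deltaAOf i.η (opsAllZdPer τ L P 𝔅 ops₀ M i m) U₀ A =
      deltaAOf i.η (opsAllZdPer τ L P 𝔅 ops₀ M i m) 1 A + DpZd i.η U₀ A := by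
  funext x μ
  have hD := congrFun (congrFun (DRDs_opsAllZdPer_eq_one hcomm τ P 𝔅 ops₀ M i m U₀ A) x) μ
  simp only [deltaAOf, Pi.add_apply, opsAllZdPer_Dp, opsAllZdPer_QQ]
  rw [hD, Jcur_eq_one hcomm i.η U₀, QQZdP_eq_one_of_comm hcomm τ hd hL 𝔅 hΩ m hU hreg A, B9Eq369CurvSmallZd.DpZd_one, Pi.zero_apply,
    Pi.zero_apply]
  abel

end Averaging

end Literature.MathematicalPhysics.QuantumFieldTheory.Balaban1983to89.B9Eq326AbelianRecordLettersZdPer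

end
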